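import Summits.ValiantsHypothesis.ValiantsHypothesis.Theorems.KPlusLogSqLawTropicalBLexCoreLaws

/-!
# Route «KPlusLogSqLaw», crux `TropicalB` (stmt-ValiantsHypothesis-19771) — LEX-NT, part 9: pairwise-law STRUCTURE of the shifted core `T_1`
# (`A = 3·2^{m−1}`, `B = 3²·1^{m−2}`, `C = 3²·2·0^{m−3}`): the quotients are Hamiltonian through BOTH top columns

HONEST FRAMING.  Structure lemmas (pairwise exchange law only) for dominance designs of any format, toward the conjectured second lex core law
«`T_1` is never realised for `m ≥ 5`» (seat val-sym-trop-p5 g14, 2026-08-28; cell `pub-symmetroid`, `--supports stmt-ValiantsHypothesis-19771 --as helper`).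
With the shift closure (`LexCore.shift_closure`, part 8) these are the hypotheses of the remaining purely combinatorial step (a slot transversal other
than `A` with at most one top cell; verified exhaustively at `m = 5, 6`, open uniformly — memo LEX-NT-g14 §5).  Nothing here bears on `TropicalB` in its
window, `WeakLifting`, DoorA26 / DoorA34, `MatrixDescartes` (stmt-ValiantsHypothesis-18050) or VP ≠ VNP.

CONTENT (`d c₀ < d c₁ < d c₂ < d c₃`; `A = (α; c₃ at p, c₂ elsewhere)`).
* `shift_pi_structure` — `B = (β; c₃ at q₁ ≠ q₂, c₁ elsewhere)` dominant after `A`, `p ∉ {q₁, q₂}`: the quotient `π = α⁻¹β` moves every column and is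
  ONE cycle containing `q₁` and `q₂` (the cycle of `p` must pay for `p`'s drop `d c₁ − d c₃` with BOTH rises `d c₃ − d c₂`; every other cycle would be
  class-decreasing).
* `shift_rho_structure` — `C = (γ; c₃ at r₁ ≠ r₂, c₂ at y, c₀ elsewhere)` dominant after `A`, `p ∉ {r₁, r₂}`: the cycle of `p` under `ρ = α⁻¹γ` contains
  `r₁` and `r₂`, and every other column is in it or is the twin fixed point `y` (`γ y = α y`, `y ≠ p`).
* `shift_coincidence` — `B` before `C`: a common cell `β b = γ b` has `b ∈ {r₁, r₂}` or `b = y ∉ {q₁, q₂}`.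
[this cell; the exchange law is the tree's `sum_d_lt_of_isDominant_invariant`]
-/

set_option linter.dupNamespace false
set_option autoImplicit false

namespace Summit.ValiantsHypothesis.ValiantsHypothesis.Theorems.KPlusLogSqLaw

namespace LexCore

open Summit.ValiantsHypothesis.ValiantsHypothesis.Theorems.MatrixDescartes.Negative
open Finset

variable {m K : ℕ}

/-- the cycle of a column as an invariant finset. [folklore] -/
theorem cycle_invariant (π : Equiv.Perm (Fin m)) (c : Fin m) :
    ∀ b, π b ∈ (univ.filter fun z => π.SameCycle c z) ↔ b ∈ (univ.filter fun z => π.SameCycle c z) := by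
  intro b
  simp only [Finset.mem_filter, Finset.mem_univ, true_and]
  exact Equiv.Perm.sameCycle_apply_right

/-- **`π = α⁻¹β` is one cycle through both top columns of `B`.**  `A = (α; c₃ at p, c₂ elsewhere)` dominant before `B = (β; c₃ at q₁ ≠ q₂, c₁
elsewhere)`, `p ∉ {q₁, q₂}`, `d c₁ < d c₂ < d c₃`.  Then `π` moves every column, every column is in the cycle of `p`, and so are `q₁, q₂`. [this cell] -/
theorem shift_pi_structure (d : Fin K → ℕ) (v ε : Fin m → Fin m → Fin K → ℤ) {θA θB : ℤ} (hAB : θA < θB)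
    {α β : Equiv.Perm (Fin m)} {lA lB : Fin m → Fin K} (hA : IsDominant d v ε θA (α, lA)) (hB : IsDominant d v ε θB (β, lB))
    (c₁ c₂ c₃ : Fin K) (h12 : d c₁ < d c₂) (h23 : d c₂ < d c₃) (p q₁ q₂ : Fin m) (hq : q₁ ≠ q₂) (hp1 : p ≠ q₁) (hp2 : p ≠ q₂)
    (hlAp : lA p = c₃) (hlA : ∀ b, b ≠ p → lA b = c₂) (hlB1 : lB q₁ = c₃) (hlB2 : lB q₂ = c₃)
    (hlB : ∀ b, b ≠ q₁ → b ≠ q₂ → lB b = c₁) :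
    (∀ b, (α⁻¹ * β) b ≠ b) ∧ (∀ b, (α⁻¹ * β).SameCycle p b) := by
  classical
  set π := α⁻¹ * β with hπ
  -- pointwise bound of the class change by a function supported on `{p, q₁, q₂}`
  have hpt : ∀ b, (d (lB b) : ℤ) - d (lA b) ≤
      (if b = p then (d c₁ : ℤ) - d c₃ else 0) + (if b = q₁ then (d c₃ : ℤ) - d c₂ else 0) + (if b = q₂ then (d c₃ : ℤ) - d c₂ else 0) := by
    intro b
    by_cases hbp : b = p
    · subst hbp
      rw [if_pos rfl, if_neg hp1, if_neg hp2, hlAp, hlB b hp1 hp2]; simp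
    · rw [if_neg hbp, hlA b hbp]
      by_cases hb1 : b = q₁
      · subst hb1; rw [if_pos rfl, if_neg hq, hlB1]; simp
      · by_cases hb2 : b = q₂
        · subst hb2; rw [if_neg hb1, if_pos rfl, hlB2]; simp
        · rw [if_neg hb1, if_neg hb2, hlB b hb1 hb2]; have := h12; omega
  -- the law on an invariant set `T` on which the terms differ, in the form `0 < Σ_T (d lB − d lA)`
  have law : ∀ T : Finset (Fin m), (∀ b, π b ∈ T ↔ b ∈ T) → (∃ b ∈ T, α b ≠ β b ∨ lA b ≠ lB b) →
      (0 : ℤ) < ∑ b ∈ T, ((d (lB b) : ℤ) - d (lA b)) := by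
    intro T hT hne
    have h := sum_d_lt_of_isDominant_invariant d v ε hAB hA hB T hT hne
    rw [Finset.sum_sub_distrib]; linarith
  have bound : ∀ T : Finset (Fin m), ∑ b ∈ T, ((d (lB b) : ℤ) - d (lA b)) ≤
      (if p ∈ T then (d c₁ : ℤ) - d c₃ else 0) + (if q₁ ∈ T then (d c₃ : ℤ) - d c₂ else 0) + (if q₂ ∈ T then (d c₃ : ℤ) - d c₂ else 0) := by
    intro T
    refine le_trans (Finset.sum_le_sum fun b _ => hpt b) ?_
    rw [Finset.sum_add_distrib, Finset.sum_add_distrib, Finset.sum_ite_eq' T p, Finset.sum_ite_eq' T q₁, Finset.sum_ite_eq' T q₂]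
  -- classes differ everywhere: `lA ∈ {c₂, c₃}`, `lB ∈ {c₁, c₃}`, and `lA b = c₃ = lB b` would need `b = p ∈ {q₁, q₂}`
  have hdiff : ∀ b, lA b ≠ lB b := by
    intro b h
    by_cases hbp : b = p
    · rw [hbp, hlAp, hlB p hp1 hp2] at h; exact (ne_of_lt (h12.trans h23)) (by rw [h])
    · rw [hlA b hbp] at h
      by_cases hb1 : b = q₁
      · rw [hb1, hlB1] at h; exact (ne_of_lt h23) (by rw [h])
      · by_cases hb2 : b = q₂
        · rw [hb2, hlB2] at h; exact (ne_of_lt h23) (by rw [h])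
        · rw [hlB b hb1 hb2] at h; exact (ne_of_lt h12) (by rw [← h])
  -- (a) the cycle of `p` contains `q₁` and `q₂`
  set T₀ := univ.filter fun z => π.SameCycle p z with hT₀
  have hpT₀ : p ∈ T₀ := by
    simp only [hT₀, Finset.mem_filter, Finset.mem_univ, true_and]; exact Equiv.Perm.SameCycle.refl _ _
  have hq₁ : q₁ ∈ T₀ ∧ q₂ ∈ T₀ := by
    have hl := law T₀ (cycle_invariant π p) ⟨p, hpT₀, Or.inr (hdiff p)⟩
    have hb := bound T₀
    rw [if_pos hpT₀] at hb
    have h13 : (d c₁ : ℤ) < d c₃ := by exact_mod_cast h12.trans h23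
    have h23' : (d c₂ : ℤ) < d c₃ := by exact_mod_cast h23
    have h12' : (d c₁ : ℤ) < d c₂ := by exact_mod_cast h12
    by_contra hnot
    rw [not_and_or] at hnot
    rcases hnot with h | h
    · rw [if_neg h] at hb; split_ifs at hb <;> linarith
    · rw [if_neg h] at hb; split_ifs at hb <;> linarith
  have hpq₁ : π.SameCycle p q₁ := by simpa [hT₀] using hq₁.1
  have hpq₂ : π.SameCycle p q₂ := by simpa [hT₀] using hq₁.2
  -- (b) every column is in the cycle of `p`
  have hall : ∀ b, π.SameCycle p b := by
    intro b
    by_contra hb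
    set T₁ := univ.filter fun z => π.SameCycle b z with hT₁
    have hbT₁ : b ∈ T₁ := by
      simp only [hT₁, Finset.mem_filter, Finset.mem_univ, true_and]; exact Equiv.Perm.SameCycle.refl _ _
    have hnot : ∀ z ∈ T₁, ¬ π.SameCycle p z := by
      intro z hz hpz
      simp only [hT₁, Finset.mem_filter, Finset.mem_univ, true_and] at hz
      exact hb (hpz.trans hz.symm)
    have hl := law T₁ (cycle_invariant π b) ⟨b, hbT₁, Or.inr (hdiff b)⟩
    have hbd := bound T₁
    rw [if_neg (fun h => hnot p h (Equiv.Perm.SameCycle.refl _ _)), if_neg (fun h => hnot q₁ h hpq₁),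
      if_neg (fun h => hnot q₂ h hpq₂)] at hbd
    linarith
  -- (c) no fixed column
  refine ⟨fun b hfix => ?_, hall⟩
  have hpb : p = b := (hall b).eq_of_right hfix
  subst hpb
  -- the cycle of a fixed `p` is `{p}`, but it contains `q₁ ≠ p`
  have : q₁ = p := ((hall q₁).symm.eq_of_right hfix)
  exact hp1 this.symm

/-- **the cycle of `p` under `ρ = α⁻¹γ` contains both top columns of `C`; the rest is in it or is the twin.**  `A` as above dominant before
`C = (γ; c₃ at r₁ ≠ r₂, c₂ at y ∉ {r₁, r₂}, c₀ elsewhere)`, `p ∉ {r₁, r₂}`, `d c₀ < d c₂ < d c₃`. [this cell] -/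
theorem shift_rho_structure (d : Fin K → ℕ) (v ε : Fin m → Fin m → Fin K → ℤ) {θA θC : ℤ} (hAC : θA < θC)
    {α γ : Equiv.Perm (Fin m)} {lA lC : Fin m → Fin K} (hA : IsDominant d v ε θA (α, lA)) (hC : IsDominant d v ε θC (γ, lC))
    (c₀ c₂ c₃ : Fin K) (h02 : d c₀ < d c₂) (h23 : d c₂ < d c₃) (p r₁ r₂ y : Fin m) (hr : r₁ ≠ r₂) (hp1 : p ≠ r₁) (hp2 : p ≠ r₂)
    (hy1 : y ≠ r₁) (hy2 : y ≠ r₂)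
    (hlAp : lA p = c₃) (hlA : ∀ b, b ≠ p → lA b = c₂) (hlC1 : lC r₁ = c₃) (hlC2 : lC r₂ = c₃) (hlCy : lC y = c₂)
    (hlC : ∀ b, b ≠ r₁ → b ≠ r₂ → b ≠ y → lC b = c₀) :
    ((α⁻¹ * γ).SameCycle p r₁ ∧ (α⁻¹ * γ).SameCycle p r₂) ∧
      ∀ b, (α⁻¹ * γ).SameCycle p b ∨ (b = y ∧ γ y = α y ∧ y ≠ p) := by
  classical
  set ρ := α⁻¹ * γ with hρ
  have hpt : ∀ b, (d (lC b) : ℤ) - d (lA b) ≤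
      (if b = p then (d c₂ : ℤ) - d c₃ else 0) + (if b = r₁ then (d c₃ : ℤ) - d c₂ else 0) + (if b = r₂ then (d c₃ : ℤ) - d c₂ else 0) := by
    intro b
    by_cases hbp : b = p
    · subst hbp
      rw [if_pos rfl, if_neg hp1, if_neg hp2, hlAp]
      by_cases hby : b = y
      · rw [hby, hlCy]; simp
      · rw [hlC b hp1 hp2 hby]; simp; have := h02; omega
    · rw [if_neg hbp, hlA b hbp]
      by_cases hb1 : b = r₁
      · subst hb1; rw [if_pos rfl, if_neg hr, hlC1]; simp
      · by_cases hb2 : b = r₂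
        · subst hb2; rw [if_neg hb1, if_pos rfl, hlC2]; simp
        · rw [if_neg hb1, if_neg hb2]
          by_cases hby : b = y
          · rw [hby, hlCy]; simp
          · rw [hlC b hb1 hb2 hby]; have := h02; omega
  have law : ∀ T : Finset (Fin m), (∀ b, ρ b ∈ T ↔ b ∈ T) → (∃ b ∈ T, α b ≠ γ b ∨ lA b ≠ lC b) →
      (0 : ℤ) < ∑ b ∈ T, ((d (lC b) : ℤ) - d (lA b)) := by
    intro T hT hne
    have h := sum_d_lt_of_isDominant_invariant d v ε hAC hA hC T hT hne
    rw [Finset.sum_sub_distrib]; linarith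
  have bound : ∀ T : Finset (Fin m), ∑ b ∈ T, ((d (lC b) : ℤ) - d (lA b)) ≤
      (if p ∈ T then (d c₂ : ℤ) - d c₃ else 0) + (if r₁ ∈ T then (d c₃ : ℤ) - d c₂ else 0) + (if r₂ ∈ T then (d c₃ : ℤ) - d c₂ else 0) := by
    intro T
    refine le_trans (Finset.sum_le_sum fun b _ => hpt b) ?_
    rw [Finset.sum_add_distrib, Finset.sum_add_distrib, Finset.sum_ite_eq' T p, Finset.sum_ite_eq' T r₁, Finset.sum_ite_eq' T r₂]
  -- classes agree only at the twin column `y ≠ p`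
  have hdiff : ∀ b, lA b = lC b → b = y ∧ y ≠ p := by
    intro b h
    by_cases hbp : b = p
    · exfalso
      rw [hbp, hlAp] at h
      by_cases hpy : p = y
      · rw [hpy, hlCy] at h; exact (ne_of_lt h23) (by rw [h])
      · rw [hlC p hp1 hp2 hpy] at h; exact (ne_of_lt (h02.trans h23)) (by rw [h])
    · rw [hlA b hbp] at h
      by_cases hb1 : b = r₁
      · exfalso; rw [hb1, hlC1] at h; exact (ne_of_lt h23) (by rw [h])
      · by_cases hb2 : b = r₂
        · exfalso; rw [hb2, hlC2] at h; exact (ne_of_lt h23) (by rw [h])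
        · by_cases hby : b = y
          · exact ⟨hby, fun e => hbp (hby.trans e)⟩
          · exfalso; rw [hlC b hb1 hb2 hby] at h; exact (ne_of_lt h02) (by rw [h])
  -- (a) `r₁, r₂` in the cycle of `p`
  set T₀ := univ.filter fun z => ρ.SameCycle p z with hT₀
  have hpT₀ : p ∈ T₀ := by
    simp only [hT₀, Finset.mem_filter, Finset.mem_univ, true_and]; exact Equiv.Perm.SameCycle.refl _ _
  have h23' : (d c₂ : ℤ) < d c₃ := by exact_mod_cast h23
  have hr12 : r₁ ∈ T₀ ∧ r₂ ∈ T₀ := by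
    have hl := law T₀ (cycle_invariant ρ p) ⟨p, hpT₀, Or.inr fun h => (hdiff p h).2 (hdiff p h).1.symm⟩
    have hb := bound T₀
    rw [if_pos hpT₀] at hb
    by_contra hnot
    rw [not_and_or] at hnot
    rcases hnot with h | h
    · rw [if_neg h] at hb; split_ifs at hb <;> linarith
    · rw [if_neg h] at hb; split_ifs at hb <;> linarith
  have hmem : ∀ z, z ∈ T₀ ↔ ρ.SameCycle p z := fun z => by simp [hT₀]
  refine ⟨⟨(hmem r₁).mp hr12.1, (hmem r₂).mp hr12.2⟩, fun b => ?_⟩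
  -- (b) any other cycle is unchanged, hence the twin fixed point
  by_cases hb : ρ.SameCycle p b
  · exact Or.inl hb
  · right
    set T₁ := univ.filter fun z => ρ.SameCycle b z with hT₁
    have hbT₁ : b ∈ T₁ := by
      simp only [hT₁, Finset.mem_filter, Finset.mem_univ, true_and]; exact Equiv.Perm.SameCycle.refl _ _
    have hnot : ∀ z ∈ T₁, ¬ ρ.SameCycle p z := by
      intro z hz hpz
      simp only [hT₁, Finset.mem_filter, Finset.mem_univ, true_and] at hz
      exact hb (hpz.trans hz.symm)
    -- if the terms differed on `T₁` the law would make the sum positive, but it is `≤ 0` there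
    have hsame : ∀ z ∈ T₁, α z = γ z ∧ lA z = lC z := by
      by_contra hne
      push Not at hne
      obtain ⟨z, hz, hzz⟩ := hne
      have hex : ∃ z ∈ T₁, α z ≠ γ z ∨ lA z ≠ lC z := by
        refine ⟨z, hz, ?_⟩
        by_cases h : α z = γ z
        · exact Or.inr (hzz h)
        · exact Or.inl h
      have hl := law T₁ (cycle_invariant ρ b) hex
      have hbd := bound T₁
      rw [if_neg (fun h => hnot p h (Equiv.Perm.SameCycle.refl _ _)), if_neg (fun h => hnot r₁ h ((hmem r₁).mp hr12.1)),
        if_neg (fun h => hnot r₂ h ((hmem r₂).mp hr12.2))] at hbd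
      linarith
    obtain ⟨hcell, hcls⟩ := hsame b hbT₁
    obtain ⟨hby, hyp⟩ := hdiff b hcls
    subst hby
    exact ⟨rfl, hcell.symm, hyp⟩

/-- **coincidences of `B` and `C` lie in `{r₁, r₂} ∪ ({y} ∖ {q₁, q₂})`.**  `B = (β; c₃ on {q₁,q₂}, c₁ elsewhere)` dominant before
`C = (γ; c₃ on {r₁,r₂}, c₂ at y, c₀ elsewhere)`, `d c₀ < d c₁ < d c₂ < d c₃`. [this cell] -/
theorem shift_coincidence (d : Fin K → ℕ) (v ε : Fin m → Fin m → Fin K → ℤ) {θB θC : ℤ} (hBC : θB < θC)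
    {β γ : Equiv.Perm (Fin m)} {lB lC : Fin m → Fin K} (hB : IsDominant d v ε θB (β, lB)) (hC : IsDominant d v ε θC (γ, lC))
    (c₀ c₁ c₂ c₃ : Fin K) (h01 : d c₀ < d c₁) (h12 : d c₁ < d c₂) (h23 : d c₂ < d c₃) (q₁ q₂ r₁ r₂ y : Fin m)
    (hlB1 : lB q₁ = c₃) (hlB2 : lB q₂ = c₃) (hlB : ∀ b, b ≠ q₁ → b ≠ q₂ → lB b = c₁)
    (hlCy : lC y = c₂) (hlC : ∀ b, b ≠ r₁ → b ≠ r₂ → b ≠ y → lC b = c₀)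
    (b : Fin m) (hb : β b = γ b) : (b = r₁ ∨ b = r₂) ∨ (b = y ∧ b ≠ q₁ ∧ b ≠ q₂) := by
  classical
  by_contra h
  push Not at h
  obtain ⟨⟨hb1, hb2⟩, hy⟩ := h
  have hfix : (β⁻¹ * γ) b = b := by
    rw [Equiv.Perm.mul_apply, Equiv.Perm.inv_eq_iff_eq]; exact hb.symm
  -- the classes at `b` differ and the later one is smaller: against the single-column exchange law
  have hlt : d (lC b) < d (lB b) := by
    by_cases hby : b = y
    · have hB3 : lB b = c₃ := by
        by_cases h1 : b = q₁
        · rw [h1, hlB1]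
        · rw [hy hby h1, hlB2]
      have hC2 : lC b = c₂ := by rw [hby, hlCy]
      rw [hB3, hC2]; exact h23
    · rw [hlC b hb1 hb2 hby]
      by_cases h1 : b = q₁
      · rw [h1, hlB1]; exact (h01.trans h12).trans h23
      · by_cases h2 : b = q₂
        · rw [h2, hlB2]; exact (h01.trans h12).trans h23
        · rw [hlB b h1 h2]; exact h01
  have hne : lB b ≠ lC b := fun h => (ne_of_lt hlt) (by rw [h])
  have hlaw := sum_d_lt_of_isDominant_invariant d v ε hBC hB hC {b} (fun c => ?_) ⟨b, Finset.mem_singleton_self b, Or.inr hne⟩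
  · simp only [Finset.sum_singleton] at hlaw
    exact absurd hlaw (not_lt.mpr (by exact_mod_cast hlt.le))
  · simp only [Finset.mem_singleton]
    constructor
    · intro hc; exact (β⁻¹ * γ).injective (hc.trans hfix.symm)
    · intro hc; rw [hc, hfix]

end LexCore

end Summit.ValiantsHypothesis.ValiantsHypothesis.Theorems.KPlusLogSqLaw
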